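import Literature.Analysis.FluidPDE.SteadyLiouvilleTsaiEnergy
import Literature.Analysis.FunctionSpaces.WeakLpQuantitative
import HarnessLib

/-!
# Seregin–Wang 2020, Theorem 1.1 (ii) (weak-Lorentz instance `ℓ = ∞`): a Liouville theorem for steady
Navier–Stokes on `ℝ³` from a sub-critical annular weak-`L^q` bound — PROVED from Tsai 2021 Thm 1.1 (a)

Topic `Literature/Analysis/FluidPDE`, story `SteadyLiouvilleCriteria` (which vendors part (i) of the
same theorem in the Lebesgue instance, `SereginWang2020_annular_liouville`, PROVED in
`SereginWangAnnularLiouvilleHolds.lean`, and Tsai's annular theorem `Tsai2021_annular_liouville`, PROVED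
in `SteadyLiouvilleTsaiEnergy.lean`). This file adds PART (ii):

> **Theorem 1.1 (ii)** (Seregin–Wang, arXiv:1805.02227, p. 3). Let `u`, `p` be a smooth solution of
> `−Δu + u·∇u = −∇p`, `div u = 0` in `ℝ³`. For `12/5 < q < 3`, `1 ≤ ℓ ≤ ∞`, `γ > 1/3 + 1/q`, suppose
> `liminf_{R→∞} M_{γ,q,ℓ}(R) < ∞`, where `M_{γ,q,ℓ}(R) := R^{γ − 3/q} ‖u‖_{L^{q,ℓ}(B_R ∖ B_{R/2})}`.
> Then `u ≡ 0`.

Typed in the tree's vocabulary for steady solutions (`IsLerayProfile ν 0 U P`, any viscosity `ν > 0`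
— the printed `ν = 1` is equivalent by `U ↦ ν⁻¹U`) in the instance `ℓ = ∞` (weak `L^q`,
`FunctionSpaces.eWeakLpPow` of `WeakLp.lean`), which is the WEAKEST hypothesis of the printed family
(`‖·‖_{L^{q,∞}} ≤ C‖·‖_{L^{q,ℓ}}`); the instances `ℓ < ∞` follow from it once Lorentz spaces `L^{q,ℓ}`
are in the tree. `-- TODO(general form): ℓ ∈ [1, ∞]` via `L^{q,ℓ} ⊂ L^{q,∞}`.

## Proof (ours; the paper's proof goes through a Caccioppoli-type iteration)
Part (ii) is a corollary of Tsai 2021 Thm 1.1 (a) (`Tsai2021_annular_liouville_holds`): for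
`δ ∈ [0,1]` with `p_δ := 6(3−δ)/(6−δ) < q` and `κ := γ(3−δ) − (4−δ)/2 > 0` — such `δ` exists exactly
because `(4−δ_q)/(2(3−δ_q)) = 1/3 + 1/q` at the endpoint `p_{δ_q} = q` — the weak-`L^q` layer cake on
the annulus (`MemWeakLp.setLIntegral_rpow_le` with `λ = R^{−γ}`) gives
`∫_{R/2<|x|<R} |u|^{p_δ} ≤ (|B₁| + (p_δ/(q−p_δ)) b^q) R^{3 − γ p_δ}` whenever `M_{γ,q,∞}(R) ≤ b`, hence
Tsai's quantity `(R/2)⁻¹‖u‖^{3−δ}_{L^{p_δ}(R/2<|x|<R)} ≤ K R^{−κ}` along the `liminf` sequence, so its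
`liminf` vanishes and Tsai's theorem gives `u = 0`.

## References
* G. Seregin, W. Wang, *Sufficient conditions on Liouville type theorems for the 3D steady
  Navier–Stokes equations*, Algebra i Analiz 31 (2019) / St. Petersburg Math. J. 31 (2020) 387–393,
  arXiv:1805.02227: Theorem 1.1 (ii), p. 3. [SereginWang2020]
* T.-P. Tsai, *Liouville type theorems for stationary Navier–Stokes equations*, SN PDE 2 (2021) 10,
  arXiv:2005.09691: Theorem 1.1 (a). [Tsai2021]
-/

noncomputable section

open MeasureTheory Set Filter Metric Topology
open scoped ENNReal NNReal

namespace Literature.Analysis.FluidPDE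

open Literature.Analysis.FunctionSpaces

/-- The SW annulus `B_R ∖ B_{R/2}` (open balls at the origin). [cite: SereginWang2020, §1 (definition of M_{γ,q,ℓ})] -/
def swAnnulus (R : ℝ) : Set (EuclideanSpace ℝ (Fin 3)) :=
  ball (0 : EuclideanSpace ℝ (Fin 3)) R \ ball (0 : EuclideanSpace ℝ (Fin 3)) (R / 2)

/-- Seregin–Wang's annular weak-Morrey quantity in the instance `ℓ = ∞`:
`M_{γ,q,∞}(R) := R^{γ − 3/q} ‖U‖_{L^{q,∞}(B_R ∖ B_{R/2})}`, valued in `ℝ≥0∞`, with the weak-`L^q`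
quasinorm `‖f‖_{L^{q,∞}(A)} = (sup_t t^q |{x ∈ A : |f| > t}|)^{1/q}` of the tree (`eWeakLpPow` for the
restricted measure). [cite: SereginWang2020, §1 (definition of M_{γ,q,ℓ}); Thm 1.1 (ii)] -/
def weakAnnularMorrey (γ q : ℝ) (U : EuclideanSpace ℝ (Fin 3) → EuclideanSpace ℝ (Fin 3)) (R : ℝ) :
    ℝ≥0∞ :=
  ENNReal.ofReal (R ^ (γ - 3 / q)) *
    (eWeakLpPow U (ENNReal.ofReal q) (volume.restrict (swAnnulus R))) ^ (1 / q)

/-- **Seregin–Wang 2020, Theorem 1.1 (ii), instance `ℓ = ∞`**: for a `C²` steady Navier–Stokes solution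
on `ℝ³` (any `ν > 0`), `12/5 < q < 3`, `γ > 1/3 + 1/q` and `liminf_{R→∞} M_{γ,q,∞}(R) < ∞` imply
`U ≡ 0`. [cite: SereginWang2020, Thm 1.1 (ii)] -/
def SereginWang2020_weak_annular_liouville : Prop :=
  ∀ ν : ℝ, 0 < ν → ∀ (U : EuclideanSpace ℝ (Fin 3) → EuclideanSpace ℝ (Fin 3))
    (P : EuclideanSpace ℝ (Fin 3) → ℝ), IsLerayProfile ν 0 U P →
    ∀ q γ : ℝ, 12 / 5 < q → q < 3 → 1 / 3 + 1 / q < γ →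
      liminf (weakAnnularMorrey γ q U) atTop < ∞ → U = 0

namespace SereginWang2020ii

/-! ### The exponent window -/

/-- Tsai's Lebesgue exponent `p_δ = 6(3−δ)/(6−δ)`. [cite: Tsai2021, Thm 1.1 (a)] -/
def pδ (δ : ℝ) : ℝ := 6 * (3 - δ) / (6 - δ)

/-- The chosen `δ = δ(q, γ) := min 1 ((δ_q + δ^γ)/2)` with `δ_q = (18−6q)/(6−q)` (`⟺ p_δ < q`) and
`δ^γ = (6γ−4)/(2γ−1)` (`⟺ κ > 0`). [cite: SereginWang2020, Thm 1.1 (ii)] -/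
def δchoice (q γ : ℝ) : ℝ := min 1 (((18 - 6 * q) / (6 - q) + (6 * γ - 4) / (2 * γ - 1)) / 2)

/-- The decay exponent `κ = γ(3−δ) − (4−δ)/2`. [cite: Tsai2021, Thm 1.1 (a)] -/
def κ (γ δ : ℝ) : ℝ := γ * (3 - δ) - (4 - δ) / 2

/-- **The exponent window is non-empty**: for `12/5 < q < 3` and `γ > 1/3 + 1/q`, the choice
`δ = δ(q, γ)` satisfies `0 ≤ δ ≤ 1`, `0 < p_δ < q` and `κ(γ, δ) > 0` — because `δ_q < δ^γ` is
equivalent to `3γq − 3 − q > 0`, i.e. to `γ > 1/3 + 1/q` (SW's threshold is exactly Tsai's endpoint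
`(4−δ_q)/(2(3−δ_q)) = 1/3 + 1/q`). [cite: SereginWang2020, Thm 1.1 (ii)] [cite: Tsai2021, Thm 1.1 (a)] -/
theorem window {q γ : ℝ} (hq1 : 12 / 5 < q) (hq2 : q < 3) (hγ : 1 / 3 + 1 / q < γ) :
    0 ≤ δchoice q γ ∧ δchoice q γ ≤ 1 ∧ 0 < pδ (δchoice q γ) ∧ pδ (δchoice q γ) < q ∧
      0 < κ γ (δchoice q γ) := by
  have hq0 : 0 < q := by linarith
  have h6q : 0 < 6 - q := by linarith
  have hγ23 : 2 / 3 < γ := by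
    have : 1 / q > 1 / 3 := by
      rw [gt_iff_lt, div_lt_div_iff₀ (by norm_num) hq0]
      linarith
    linarith
  have h2γ : 0 < 2 * γ - 1 := by linarith
  -- the key inequality 3γq − 3 − q > 0
  have hkey : 0 < 3 * γ * q - 3 - q := by
    have h1 : 1 / 3 + 1 / q < γ := hγ
    have h2 : (1 / 3 + 1 / q) * (3 * q) < γ * (3 * q) := by
      exact mul_lt_mul_of_pos_right h1 (by linarith)
    have h3 : (1 / 3 + 1 / q) * (3 * q) = q + 3 := by field_simp
    nlinarith
  set dq : ℝ := (18 - 6 * q) / (6 - q) with hdq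
  set dg : ℝ := (6 * γ - 4) / (2 * γ - 1) with hdg
  have hdq_pos : 0 < dq := div_pos (by linarith) h6q
  have hdq_lt_one : dq < 1 := by rw [hdq, div_lt_one h6q]; linarith
  have hdq_lt_dg : dq < dg := by
    rw [hdq, hdg, div_lt_div_iff₀ h6q h2γ]; nlinarith
  set δ : ℝ := δchoice q γ with hδdef
  have hδ_eq : δ = min 1 ((dq + dg) / 2) := rfl
  have hδ_gt : dq < δ := by
    rw [hδ_eq]; refine lt_min hdq_lt_one (by linarith)
  have hδ_lt : δ < dg := by
    rw [hδ_eq]; rcases le_or_gt 1 ((dq + dg) / 2) with h | h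
    · rw [min_eq_left h]; linarith
    · rw [min_eq_right h.le]; linarith
  have hδ0 : 0 ≤ δ := (hdq_pos.trans hδ_gt).le
  have hδ1 : δ ≤ 1 := min_le_left _ _
  have h6δ : 0 < 6 - δ := by linarith
  refine ⟨hδ0, hδ1, ?_, ?_, ?_⟩
  · exact div_pos (by linarith) h6δ
  · -- pδ δ < q ⟺ δ(6−q) > 18 − 6q ⟺ δ > dq
    rw [pδ, div_lt_iff₀ h6δ]
    have : dq * (6 - q) < δ * (6 - q) := mul_lt_mul_of_pos_right hδ_gt h6q
    have e : dq * (6 - q) = 18 - 6 * q := by rw [hdq]; exact div_mul_cancel₀ _ h6q.ne'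
    nlinarith
  · -- κ > 0 ⟺ δ(2γ−1) < 6γ − 4 ⟺ δ < dg
    rw [κ]
    have : δ * (2 * γ - 1) < dg * (2 * γ - 1) := mul_lt_mul_of_pos_right hδ_lt h2γ
    have e : dg * (2 * γ - 1) = 6 * γ - 4 := by rw [hdg]; exact div_mul_cancel₀ _ h2γ.ne'
    nlinarith

/-! ### From the Morrey bound to a bound on the weak quasinorm -/

/-- If `M_{γ,q,∞}(R) ≤ b` then `sup_t t^q |{x ∈ A_R : |U| > t}| ≤ b^q R^{3 − γq}` (`R > 0`, `q > 0`).
[cite: SereginWang2020, §1 (definition of M_{γ,q,ℓ})] -/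
theorem eWeakLpPow_le_of_morrey_le {γ q : ℝ} (hq : 0 < q)
    {U : EuclideanSpace ℝ (Fin 3) → EuclideanSpace ℝ (Fin 3)} {R : ℝ} (hR : 0 < R) {b : ℝ≥0∞}
    (h : weakAnnularMorrey γ q U R ≤ b) :
    eWeakLpPow U (ENNReal.ofReal q) (volume.restrict (swAnnulus R)) ≤
      b ^ q * ENNReal.ofReal (R ^ (3 - γ * q)) := by
  set W := eWeakLpPow U (ENNReal.ofReal q) (volume.restrict (swAnnulus R)) with hW
  have hx0 : ENNReal.ofReal (R ^ (γ - 3 / q)) ≠ 0 := by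
    rw [ENNReal.ofReal_ne_zero_iff]; exact Real.rpow_pos_of_pos hR _
  have hxt : ENNReal.ofReal (R ^ (γ - 3 / q)) ≠ ∞ := ENNReal.ofReal_ne_top
  -- `W^{1/q} ≤ b / R^{γ−3/q}`
  have h1 : W ^ (1 / q) ≤ b / ENNReal.ofReal (R ^ (γ - 3 / q)) := by
    rw [ENNReal.le_div_iff_mul_le (Or.inl hx0) (Or.inl hxt), mul_comm]
    exact h
  have h2 : W = (W ^ (1 / q)) ^ q := by
    rw [← ENNReal.rpow_mul, one_div_mul_cancel hq.ne', ENNReal.rpow_one]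
  rw [h2]
  calc (W ^ (1 / q)) ^ q ≤ (b / ENNReal.ofReal (R ^ (γ - 3 / q))) ^ q := by gcongr
    _ = b ^ q * (ENNReal.ofReal (R ^ (γ - 3 / q)))⁻¹ ^ q := by
        rw [div_eq_mul_inv, ENNReal.mul_rpow_of_nonneg _ _ hq.le]
    _ = b ^ q * ENNReal.ofReal (R ^ (3 - γ * q)) := by
        congr 1
        rw [← ENNReal.ofReal_inv_of_pos (Real.rpow_pos_of_pos hR _), ← Real.rpow_neg hR.le,
          ENNReal.ofReal_rpow_of_pos (Real.rpow_pos_of_pos hR _), ← Real.rpow_mul hR.le]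
        congr 1
        rw [show -(γ - 3 / q) * q = 3 - γ * q by field_simp; ring]

/-! ### The layer cake on Tsai's annulus `{R/2 < |x| < R}` -/

/-- Tsai's annulus at radius `R/2`, `L = 2`, sits inside the SW annulus `B_R ∖ B_{R/2}`. [folklore] -/
private theorem tsaiSet_subset_swAnnulus (R : ℝ) :
    {x : EuclideanSpace ℝ (Fin 3) | R / 2 < ‖x‖ ∧ ‖x‖ < 2 * (R / 2)} ⊆ swAnnulus R := by
  intro x hx
  simp only [mem_setOf_eq] at hx
  refine ⟨?_, ?_⟩
  · rw [mem_ball, dist_zero_right]; linarith [hx.2]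
  · rw [mem_ball, dist_zero_right, not_lt]; exact hx.1.le

/-- … and inside `B_R`, so its volume is at most `R³|B₁|`. [folklore] -/
private theorem volume_tsaiSet_le {R : ℝ} (hR : 0 < R) :
    volume {x : EuclideanSpace ℝ (Fin 3) | R / 2 < ‖x‖ ∧ ‖x‖ < 2 * (R / 2)} ≤
      ENNReal.ofReal (R ^ 3) * volume (ball (0 : EuclideanSpace ℝ (Fin 3)) 1) := by
  calc volume {x : EuclideanSpace ℝ (Fin 3) | R / 2 < ‖x‖ ∧ ‖x‖ < 2 * (R / 2)}
      ≤ volume (ball (0 : EuclideanSpace ℝ (Fin 3)) R) := by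
        refine measure_mono fun x hx => ?_
        simp only [mem_setOf_eq] at hx
        rw [mem_ball, dist_zero_right]; linarith [hx.2]
    _ = ENNReal.ofReal (R ^ 3) * volume (ball (0 : EuclideanSpace ℝ (Fin 3)) 1) := by
        rw [Measure.addHaar_ball_of_pos volume (0 : EuclideanSpace ℝ (Fin 3)) hR]
        simp [finrank_euclideanSpace]

/-- Tsai's set is measurable. [folklore] -/
private theorem measurableSet_tsaiSet (R : ℝ) :
    MeasurableSet {x : EuclideanSpace ℝ (Fin 3) | R / 2 < ‖x‖ ∧ ‖x‖ < 2 * (R / 2)} :=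
  (measurableSet_lt measurable_const measurable_norm).inter
    (measurableSet_lt measurable_norm measurable_const)

/-- **Weak-`L^q` ⊂ `L^p` on the annulus, quantitatively** (the Lorentz nesting SW use on p. 3): if
`M_{γ,q,∞}(R) ≤ b < ∞` and `0 < p < q`, then `∫_{R/2<|x|<R} |U|^p ≤ (|B₁| + (p/(q−p)) b^q) R^{3−γp}`
(layer cake `MemWeakLp.setLIntegral_rpow_le` at height `λ = R^{−γ}`). [cite: SereginWang2020, Thm 1.1 (ii)] -/
theorem lintegral_tsaiSet_le {γ q p : ℝ} (hp : 0 < p) (hpq : p < q)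
    {U : EuclideanSpace ℝ (Fin 3) → EuclideanSpace ℝ (Fin 3)} (hU : Continuous U)
    {R : ℝ} (hR : 0 < R) {b : ℝ≥0∞} (h : weakAnnularMorrey γ q U R ≤ b) :
    ∫⁻ x in {x : EuclideanSpace ℝ (Fin 3) | R / 2 < ‖x‖ ∧ ‖x‖ < 2 * (R / 2)}, ‖U x‖ₑ ^ p ≤
      (volume (ball (0 : EuclideanSpace ℝ (Fin 3)) 1) + ENNReal.ofReal (p / (q - p)) * b ^ q) *
        ENNReal.ofReal (R ^ (3 - γ * p)) := by
  have hq : 0 < q := hp.trans hpq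
  set A := swAnnulus R with hA
  set T := {x : EuclideanSpace ℝ (Fin 3) | R / 2 < ‖x‖ ∧ ‖x‖ < 2 * (R / 2)} with hT
  set μ : Measure (EuclideanSpace ℝ (Fin 3)) := volume.restrict A with hμ
  have hTA : T ⊆ A := tsaiSet_subset_swAnnulus R
  have hTm : MeasurableSet T := measurableSet_tsaiSet R
  -- the layer cake for the restricted measure
  have hlc := MemWeakLp.setLIntegral_rpow_le (p := ENNReal.ofReal q) (μ := μ)
    (hU.aestronglyMeasurable) (r := p) hp (by rw [ENNReal.toReal_ofReal hq.le]; exact hpq) T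
    (lam := R ^ (-γ)) (Real.rpow_pos_of_pos hR _)
  rw [ENNReal.toReal_ofReal hq.le] at hlc
  -- `∫_T … ∂μ = ∫_T … ∂volume` and `μ T = volume T` since `T ⊆ A`
  have hres : μ.restrict T = volume.restrict T := by
    rw [hμ, Measure.restrict_restrict hTm, inter_eq_left.2 hTA]
  have hμT : μ T = volume T := by
    rw [hμ, Measure.restrict_apply hTm, inter_eq_left.2 hTA]
  rw [hres, hμT] at hlc
  refine hlc.trans ?_
  have hW := eWeakLpPow_le_of_morrey_le (γ := γ) hq hR h
  -- the two real constants
  have e1 : (R ^ (-γ)) ^ p = R ^ (-(γ * p)) := by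
    rw [← Real.rpow_mul hR.le]; ring_nf
  have e2 : p / (q - p) * (R ^ (-γ)) ^ (p - q) = p / (q - p) * R ^ (γ * q - γ * p) := by
    rw [← Real.rpow_mul hR.le]; ring_nf
  rw [e1, e2]
  have hpq' : 0 < q - p := by linarith
  calc volume T * ENNReal.ofReal (R ^ (-(γ * p))) +
        ENNReal.ofReal (p / (q - p) * R ^ (γ * q - γ * p)) * eWeakLpPow U (ENNReal.ofReal q) μ
      ≤ ENNReal.ofReal (R ^ 3) * volume (ball (0 : EuclideanSpace ℝ (Fin 3)) 1) *
            ENNReal.ofReal (R ^ (-(γ * p))) +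
          ENNReal.ofReal (p / (q - p) * R ^ (γ * q - γ * p)) *
            (b ^ q * ENNReal.ofReal (R ^ (3 - γ * q))) := by
        gcongr
        exact volume_tsaiSet_le hR
    _ = (volume (ball (0 : EuclideanSpace ℝ (Fin 3)) 1) + ENNReal.ofReal (p / (q - p)) * b ^ q) *
          ENNReal.ofReal (R ^ (3 - γ * p)) := by
        have e3 : ENNReal.ofReal (R ^ 3) * ENNReal.ofReal (R ^ (-(γ * p))) =
            ENNReal.ofReal (R ^ (3 - γ * p)) := by
          rw [← ENNReal.ofReal_mul (by positivity), show (R ^ 3 : ℝ) = R ^ (3 : ℝ) by norm_cast,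
            ← Real.rpow_add hR]; ring_nf
        have e4 : ENNReal.ofReal (p / (q - p) * R ^ (γ * q - γ * p)) * ENNReal.ofReal (R ^ (3 - γ * q)) =
            ENNReal.ofReal (p / (q - p)) * ENNReal.ofReal (R ^ (3 - γ * p)) := by
          rw [ENNReal.ofReal_mul (div_pos hp hpq').le, mul_assoc, ← ENNReal.ofReal_mul (by positivity),
            ← Real.rpow_add hR]; ring_nf
        calc ENNReal.ofReal (R ^ 3) * volume (ball (0 : EuclideanSpace ℝ (Fin 3)) 1) *
              ENNReal.ofReal (R ^ (-(γ * p))) +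
            ENNReal.ofReal (p / (q - p) * R ^ (γ * q - γ * p)) * (b ^ q * ENNReal.ofReal (R ^ (3 - γ * q)))
            = volume (ball (0 : EuclideanSpace ℝ (Fin 3)) 1) *
                (ENNReal.ofReal (R ^ 3) * ENNReal.ofReal (R ^ (-(γ * p)))) +
              b ^ q * (ENNReal.ofReal (p / (q - p) * R ^ (γ * q - γ * p)) *
                ENNReal.ofReal (R ^ (3 - γ * q))) := by ring
          _ = _ := by rw [e3, e4]; ring

/-! ### Tsai's quantity along the Morrey sequence -/

/-- Tsai's quantity unfolded at radius `R/2`, `L = 2`, exponent `δ`. [cite: Tsai2021, Thm 1.1 (a)] -/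
private theorem tsaiQ_half (δ : ℝ) (U : EuclideanSpace ℝ (Fin 3) → EuclideanSpace ℝ (Fin 3)) (R : ℝ) :
    tsaiAnnulusQuantity δ 2 U (R / 2) =
      (ENNReal.ofReal (R / 2))⁻¹ *
        (∫⁻ x in {x : EuclideanSpace ℝ (Fin 3) | R / 2 < ‖x‖ ∧ ‖x‖ < 2 * (R / 2)},
          ‖U x‖ₑ ^ (pδ δ)) ^ ((6 - δ) / 6) := by
  simp only [tsaiAnnulusQuantity, pδ]

/-- **Decay of Tsai's quantity along the Morrey bound**: if `M_{γ,q,∞}(R) ≤ b < ∞`, `0 ≤ δ < 6` with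
`0 < p_δ < q`, then `(R/2)⁻¹ ‖U‖^{3−δ}_{L^{p_δ}(R/2<|x|<R)} ≤ 2 K^{(6−δ)/6} R^{−κ}`,
`K = |B₁| + (p_δ/(q−p_δ)) b^q`, `κ = γ(3−δ) − (4−δ)/2`. [cite: SereginWang2020, Thm 1.1 (ii)] [cite: Tsai2021, Thm 1.1 (a)] -/
theorem tsaiQ_half_le {γ q δ : ℝ} (hδ6 : δ < 6) (hp : 0 < pδ δ) (hpq : pδ δ < q)
    {U : EuclideanSpace ℝ (Fin 3) → EuclideanSpace ℝ (Fin 3)} (hU : Continuous U)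
    {R : ℝ} (hR : 0 < R) {b : ℝ≥0∞} (h : weakAnnularMorrey γ q U R ≤ b) :
    tsaiAnnulusQuantity δ 2 U (R / 2) ≤
      2 * (volume (ball (0 : EuclideanSpace ℝ (Fin 3)) 1) +
          ENNReal.ofReal (pδ δ / (q - pδ δ)) * b ^ q) ^ ((6 - δ) / 6) *
        ENNReal.ofReal (R ^ (-κ γ δ)) := by
  set K := volume (ball (0 : EuclideanSpace ℝ (Fin 3)) 1) +
      ENNReal.ofReal (pδ δ / (q - pδ δ)) * b ^ q with hK
  have he : 0 ≤ (6 - δ) / 6 := div_nonneg (by linarith) (by norm_num)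
  rw [tsaiQ_half]
  have h1 := lintegral_tsaiSet_le (γ := γ) hp hpq hU hR h
  -- exponent identity: (3 − γ p_δ)(6−δ)/6 = (6−δ)/2 − γ(3−δ)
  have h6 : (6 : ℝ) - δ ≠ 0 := by linarith
  have hexp : (3 - γ * pδ δ) * ((6 - δ) / 6) = (6 - δ) / 2 - γ * (3 - δ) := by
    rw [pδ]; field_simp; ring
  calc (ENNReal.ofReal (R / 2))⁻¹ *
        (∫⁻ x in {x : EuclideanSpace ℝ (Fin 3) | R / 2 < ‖x‖ ∧ ‖x‖ < 2 * (R / 2)},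
          ‖U x‖ₑ ^ (pδ δ)) ^ ((6 - δ) / 6)
      ≤ (ENNReal.ofReal (R / 2))⁻¹ * (K * ENNReal.ofReal (R ^ (3 - γ * pδ δ))) ^ ((6 - δ) / 6) := by
        gcongr
    _ = (ENNReal.ofReal (R / 2))⁻¹ * (K ^ ((6 - δ) / 6) *
          ENNReal.ofReal (R ^ ((6 - δ) / 2 - γ * (3 - δ)))) := by
        rw [ENNReal.mul_rpow_of_nonneg _ _ he, ENNReal.ofReal_rpow_of_nonneg (by positivity) he,
          ← Real.rpow_mul hR.le, hexp]
    _ = 2 * K ^ ((6 - δ) / 6) * ENNReal.ofReal (R ^ (-κ γ δ)) := by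
        rw [← ENNReal.ofReal_inv_of_pos (by positivity), inv_div,
          show ENNReal.ofReal (2 / R) = 2 * ENNReal.ofReal (R ^ (-(1 : ℝ))) by
            rw [Real.rpow_neg_one, div_eq_mul_inv, ENNReal.ofReal_mul (by norm_num : (0:ℝ) ≤ 2),
              ENNReal.ofReal_ofNat]]
        rw [mul_assoc, mul_assoc, mul_left_comm (ENNReal.ofReal _), ← ENNReal.ofReal_mul
          (Real.rpow_nonneg hR.le _), ← Real.rpow_add hR]
        congr 3
        rw [κ]; ring

/-! ### Conclusion -/

/-- **`liminf` of Tsai's quantity vanishes** under the SW hypothesis. [cite: SereginWang2020, Thm 1.1 (ii)]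
[cite: Tsai2021, Thm 1.1 (a)] -/
theorem liminf_tsaiQ_eq_zero {γ q δ : ℝ} (hδ6 : δ < 6) (hp : 0 < pδ δ) (hpq : pδ δ < q)
    (hκ : 0 < κ γ δ) {U : EuclideanSpace ℝ (Fin 3) → EuclideanSpace ℝ (Fin 3)} (hU : Continuous U)
    (hlim : liminf (weakAnnularMorrey γ q U) atTop < ∞) :
    liminf (tsaiAnnulusQuantity δ 2 U) atTop = 0 := by
  -- a finite level `b` below which the Morrey quantity falls frequently
  set b : ℝ≥0∞ := liminf (weakAnnularMorrey γ q U) atTop + 1 with hb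
  have hbtop : b ≠ ∞ := ENNReal.add_ne_top.2 ⟨hlim.ne, ENNReal.one_ne_top⟩
  have hfreq : ∃ᶠ R in atTop, weakAnnularMorrey γ q U R < b :=
    frequently_lt_of_liminf_lt (by isBoundedDefault) (ENNReal.lt_add_right hlim.ne one_ne_zero)
  -- the majorant `2 K^{(6−δ)/6} R^{−κ}` tends to `0`
  set K : ℝ≥0∞ := volume (ball (0 : EuclideanSpace ℝ (Fin 3)) 1) +
      ENNReal.ofReal (pδ δ / (q - pδ δ)) * b ^ q with hK
  have hKtop : 2 * K ^ ((6 - δ) / 6) ≠ ∞ := by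
    refine ENNReal.mul_ne_top (by norm_num) (ENNReal.rpow_ne_top_of_nonneg
      (div_nonneg (by linarith) (by norm_num)) ?_)
    exact ENNReal.add_ne_top.2 ⟨measure_ball_lt_top.ne, ENNReal.mul_ne_top ENNReal.ofReal_ne_top
      (ENNReal.rpow_ne_top_of_nonneg (hp.trans hpq).le hbtop)⟩
  have hmaj : Tendsto (fun R : ℝ => 2 * K ^ ((6 - δ) / 6) * ENNReal.ofReal (R ^ (-κ γ δ)))
      atTop (𝓝 0) := by
    have h0 : Tendsto (fun R : ℝ => R ^ (-κ γ δ)) atTop (𝓝 0) := tendsto_rpow_neg_atTop hκ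
    have h1 : Tendsto (fun R : ℝ => ENNReal.ofReal (R ^ (-κ γ δ))) atTop (𝓝 0) := by
      simpa using ENNReal.tendsto_ofReal h0
    simpa using ENNReal.Tendsto.const_mul h1 (Or.inr hKtop)
  -- for every `ε > 0`, the quantity is `≤ ε` frequently (at the radii `R/2`)
  refine le_antisymm ?_ bot_le
  refine ENNReal.le_of_forall_pos_le_add fun ε hε _ => ?_
  rw [zero_add]
  have hε' : (0 : ℝ≥0∞) < ε := by exact_mod_cast hε
  have hev : ∀ᶠ R in atTop, 2 * K ^ ((6 - δ) / 6) * ENNReal.ofReal (R ^ (-κ γ δ)) ≤ ε :=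
    (hmaj.eventually (ge_mem_nhds hε')).mono fun R hR => hR
  have hfreq2 : ∃ᶠ R in atTop, tsaiAnnulusQuantity δ 2 U (R / 2) ≤ ε := by
    refine (hfreq.and_eventually (hev.and (eventually_gt_atTop 0))).mono fun R hR => ?_
    obtain ⟨hM, hmajR, hR0⟩ := hR
    exact (tsaiQ_half_le hδ6 hp hpq hU hR0 hM.le).trans hmajR
  have hfreq3 : ∃ᶠ R' in atTop, tsaiAnnulusQuantity δ 2 U R' ≤ ε :=
    (tendsto_id.atTop_div_const (by norm_num : (0 : ℝ) < 2)).frequently hfreq2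
  exact liminf_le_of_frequently_le' hfreq3

end SereginWang2020ii

open SereginWang2020ii in
/-- **Seregin–Wang 2020, Theorem 1.1 (ii) (`ℓ = ∞`) HOLDS** — derived from Tsai 2021 Thm 1.1 (a)
(`Tsai2021_annular_liouville_holds`) at `δ = δ(q, γ)` of the exponent window and the weak-`L^q` layer cake
on annuli. [cite: SereginWang2020, Thm 1.1 (ii)] [cite: Tsai2021, Thm 1.1 (a)] -/
theorem SereginWang2020_weak_annular_liouville_holds : SereginWang2020_weak_annular_liouville := by
  intro ν hν U P hprof q γ hq1 hq2 hγ hlim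
  obtain ⟨hδ0, hδ1, hp, hpq, hκ⟩ := window hq1 hq2 hγ
  have hU : Continuous U := hprof.contDiff_velocity.continuous
  exact Tsai2021_annular_liouville_holds ν hν U P hprof (δchoice q γ) 2 hδ0 hδ1 one_lt_two
    (liminf_tsaiQ_eq_zero (by linarith) hp hpq hκ hU hlim)

end Literature.Analysis.FluidPDE

end
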